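import Summits.BirchSwinnertonDyer.Rank1Residual.Additive.TypeGRamification
import Summits.BirchSwinnertonDyer.Rank1Residual.Additive.SemistabilityDefectRamification
import Summits.BirchSwinnertonDyer.Rank1Residual.Additive.WildThreeKrausCells
import Summits.BirchSwinnertonDyer.Rank1Residual.Additive.SubGordHigherOrdinary
import Mathlib.NumberTheory.NumberField.Cyclotomic.Ideal
import HarnessLib

/-!
# `(G₉)` rows have even `ord₃ Δ_min`: the cheap half of the converse of `GNineCriterion`

Route `CyclotomicUntwist` (sub-problem `BirchSwinnertonDyer`), crux `PSRankOneLowerHalfAtThree`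
(item stmt-BirchSwinnertonDyer-21580). The route's first lemma `GNineCriterion`
(`Theorems/CyclotomicUntwistPSRankOneLowerHalfAtThreeGNineCriterion.lean`) proves
"square `Δ_min` on the additive potentially-good locus at `3` ⟹ `TypeGNine`" (good reduction over
`ℚ(ζ₉)`). This file records the part of the CONVERSE that is pure ramification bookkeeping — the
inclusion "`(G₉) ∩ (w) ⊆` cyclic-inertia part" left UNASSERTED in the docstrings of
`Additive/WildThreeKrausCells.lean` (`TypeGNine`, `SubWCyclic`):
* `ramificationIdx_dvd_six_of_intermediateField_cyclotomic_nine` — in a subfield `F ⊆ ℚ(ζ₉)`,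
  `e(w|3) ∣ 6` for every prime `w ∣ 3` (tower `e(𝔓|3) = e(w|3)·e(𝔓|w)` with `e(𝔓|3) = 6`, Mathlib
  `IsCyclotomicExtension.Rat.ramificationIdx_eq_of_prime_pow`; the `p = 3, k = 1` analogue of
  `ramificationIdx_dvd_sub_one_of_intermediateField_cyclotomic`);
* `two_dvd_padicValRat_Δ_of_typeGNine` — `TypeGNine W ⟹ 2 ∣ ord₃ Δ(W)` for any model (good
  reduction at `w` forces `12 ∣ e(w|3)·ord₃ Δ`, `e(w|3) ∣ 6`);
* `even_padicValInt_minimalDiscriminantInt_of_typeGNine`, `subWCyclic_of_subW_of_typeGNine` —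
  on a globally minimal model: `TypeGNine W → Even (ord₃ Δ_min)`, hence `(G₉) ∩ (w) ⊆ SubWCyclic`
  (Kraus's cyclic inertia `C₃/C₆`; the dicyclic rows `v₃(Δ_min)` odd are never `(G₉)`).
The remaining half of the converse ("`(G₉)` on the wild cell ⟹ `Δ_min/3^v ≡ 1 (mod 3)`", i.e. the
supercuspidal-unramified rows are not `(G₉)`) needs an argument over the completion and is NOT
asserted here.

Theorems only; no definition, no named fact; nothing about BSD is asserted.
References: L. Washington, *Cyclotomic Fields*, Lemma 1.4, Prop. 2.3; J. H. Silverman, *AEC*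
VII.1.3; A. Kraus, Manuscripta Math. 69 (1990).
-/

noncomputable section

open scoped Classical NumberField

open WeierstrassCurve IsDedekindDomain IsDedekindDomain.HeightOneSpectrum NumberField
  Literature.NumberTheory.EllipticCurves Literature.NumberTheory.EllipticCurves.Rank1Residual
  Summit.BirchSwinnertonDyer.Rank1Residual.Additive

set_option linter.dupNamespace false

namespace Summit.BirchSwinnertonDyer.BirchSwinnertonDyer.Theorems.GNineCriterion

/-- **In a subfield `F` of a `9`-th cyclotomic field, `e(w|3) ∣ 6` for a prime `w ∣ 3`**: choose a
prime `𝔓` of `ℚ(ζ₉) ⊇ F` above `w`; `e(𝔓|3) = e(w|3)·e(𝔓|w)` (Mathlib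
`Ideal.ramificationIdx'_algebra_tower`) and `e(𝔓|3) = 3·2 = 6` (total ramification, Mathlib
`IsCyclotomicExtension.Rat.ramificationIdx_eq_of_prime_pow`). [folklore] -/
theorem ramificationIdx_dvd_six_of_intermediateField_cyclotomic_nine {L : Type} [Field L]
    [NumberField L] [hcyc : IsCyclotomicExtension {3 ^ (1 + 1)} ℚ L]
    (F : IntermediateField ℚ L) (w : HeightOneSpectrum (𝓞 F))
    [hw : w.asIdeal.LiesOver (Ideal.span {((3 : ℕ) : ℤ)})] :
    (Ideal.span {((3 : ℕ) : ℤ)}).ramificationIdx' w.asIdeal ∣ 6 := by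
  haveI : Fact (Nat.Prime 3) := ⟨Nat.prime_three⟩
  haveI : NumberField F := NumberField.of_module_finite ℚ F
  haveI := w.isMaximal
  obtain ⟨Q, hQmax, hQover⟩ :=
    Ideal.exists_maximal_ideal_liesOver_of_isIntegral (S := 𝓞 L) w.asIdeal
  haveI := hQover
  haveI : Q.IsPrime := hQmax.isPrime
  haveI : Q.LiesOver (Ideal.span {((3 : ℕ) : ℤ)}) := Ideal.LiesOver.trans Q w.asIdeal _
  have hpbot : Ideal.span {((3 : ℕ) : ℤ)} ≠ ⊥ := by
    rw [Ne, Ideal.span_singleton_eq_bot]; norm_num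
  have heL : (Ideal.span {((3 : ℕ) : ℤ)}).ramificationIdx' Q = 6 := by
    rw [Ideal.ramificationIdx'_eq_ramificationIdx _ _ hpbot,
      IsCyclotomicExtension.Rat.ramificationIdx_eq_of_prime_pow 3 1 L Q]
    norm_num
  have hg0 : Ideal.map (algebraMap (𝓞 F) (𝓞 L)) w.asIdeal ≠ ⊥ := by
    rw [Ne, Ideal.map_eq_bot_iff_of_injective (RingOfIntegers.algebraMap.injective F L)]
    exact w.ne_bot
  have hfg : Ideal.map (algebraMap ℤ (𝓞 L)) (Ideal.span {((3 : ℕ) : ℤ)}) ≠ ⊥ :=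
    Ideal.map_ne_bot_of_ne_bot hpbot
  have hg : Ideal.map (algebraMap (𝓞 F) (𝓞 L)) w.asIdeal ≤ Q :=
    Ideal.map_le_iff_le_comap.mpr (le_of_eq (hQover.over))
  have htower := Ideal.ramificationIdx'_algebra_tower (p := Ideal.span {((3 : ℕ) : ℤ)}) hg0 hfg hg
  rw [heL] at htower
  exact Dvd.intro _ htower.symm

/-- **`(G₉)` forces `2 ∣ ord₃ Δ`** (any model `W/ℚ`): if `E_F` has good reduction above `3` for a
subfield `F ⊆ ℚ(ζ₉)`, then at a place `w ∣ 3` of `F`, `12 ∣ e(w|3)·ord₃ Δ`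
(`twelve_dvd_ramificationIdx_mul_padicValRat_Δ_of_hasGoodReductionAt`) and `e(w|3) ∣ 6`, so
`ord₃ Δ` is even. [cite: SilvermanAEC2009, VII.1 Prop. 1.3] -/
theorem two_dvd_padicValRat_Δ_of_typeGNine (W : WeierstrassCurve ℚ) [W.IsElliptic]
    (h : TypeGNine W) : (2 : ℤ) ∣ padicValRat 3 W.Δ := by
  haveI hp : Fact (Nat.Prime 3) := ⟨Nat.prime_three⟩
  obtain ⟨L, _, _, hcycL, F, hF⟩ := h
  haveI : NumberField F := NumberField.of_module_finite ℚ F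
  haveI hcyc' : IsCyclotomicExtension {3 ^ (1 + 1)} ℚ L := by
    rw [show (3 : ℕ) ^ (1 + 1) = 9 by norm_num]; exact hcycL
  obtain ⟨w, hw⟩ := exists_heightOneSpectrum_natCast_mem F 3
  have h12 := twelve_dvd_ramificationIdx_mul_padicValRat_Δ_of_hasGoodReductionAt W 3 F w hw (hF w hw)
  haveI : w.asIdeal.LiesOver (Ideal.span {((3 : ℕ) : ℤ)}) := liesOver_span_of_natCast_mem 3 F w hw
  obtain ⟨c, hc⟩ := ramificationIdx_dvd_six_of_intermediateField_cyclotomic_nine F w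
  obtain ⟨m, hm⟩ := h12
  -- `e·v = 12 m`, `e·c = 6` ⟹ `6 v = 12 m c` ⟹ `v = 2 m c`
  refine ⟨m * c, ?_⟩
  have hc' : ((Ideal.span {((3 : ℕ) : ℤ)}).ramificationIdx' w.asIdeal : ℤ) * (c : ℤ) = 6 := by
    exact_mod_cast hc.symm
  have key : (6 : ℤ) * padicValRat 3 W.Δ = 6 * (2 * (m * c)) := by
    calc (6 : ℤ) * padicValRat 3 W.Δ
        = (((Ideal.span {((3 : ℕ) : ℤ)}).ramificationIdx' w.asIdeal : ℤ) * padicValRat 3 W.Δ)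
            * (c : ℤ) := by rw [← hc']; ring
      _ = 12 * m * c := by rw [hm]
      _ = 6 * (2 * (m * c)) := by ring
  exact mul_left_cancel₀ (by norm_num : (6 : ℤ) ≠ 0) key

/-- **`(G₉)` rows have even `ord₃ Δ_min`** (globally minimal model). [cite: Kraus1990, Théorème 1 (p = 3)] -/
theorem even_padicValInt_minimalDiscriminantInt_of_typeGNine (W : WeierstrassCurve ℚ) [W.IsElliptic]
    [W.IsGloballyMinimal] (h : TypeGNine W) : Even (padicValInt 3 W.minimalDiscriminantInt) := by
  haveI hp : Fact (Nat.Prime 3) := ⟨Nat.prime_three⟩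
  have h2 := two_dvd_padicValRat_Δ_of_typeGNine W h
  rw [padicValRat_Δ_eq W 3] at h2
  obtain ⟨k, hk⟩ := h2
  exact ⟨k.toNat, by omega⟩

/-- **`(G₉) ∩ (w) ⊆` the cyclic-inertia part of the wild cell at `3`** (`SubWCyclic`: `v₃(Δ_min)`
even, Kraus's `Φ ∈ {C₃, C₆}`): the inclusion recorded but not asserted in
`Additive/WildThreeKrausCells.lean`. The dicyclic rows (`v₃(Δ_min)` odd, `Φ ≅ C₃ ⋊ C₄`) are never
of type `(G₉)`. [cite: Kraus1990, Théorème 1 (p = 3)] -/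
theorem subWCyclic_of_subW_of_typeGNine (W : WeierstrassCurve ℚ) [W.IsElliptic]
    [W.IsGloballyMinimal] (hW : SubW W 3) (h : TypeGNine W) : SubWCyclic W :=
  ⟨hW, even_padicValInt_minimalDiscriminantInt_of_typeGNine W h⟩

/-- The dicyclic part of the wild cell is disjoint from `(G₉)`. [cite: Kraus1990, Théorème 1 (p = 3)] -/
theorem not_typeGNine_of_subWDicyclic (W : WeierstrassCurve ℚ) [W.IsElliptic]
    [W.IsGloballyMinimal] (hW : SubWDicyclic W) : ¬ TypeGNine W := fun h ↦
  (Nat.not_even_iff_odd.mpr hW.2) (even_padicValInt_minimalDiscriminantInt_of_typeGNine W h)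

end Summit.BirchSwinnertonDyer.BirchSwinnertonDyer.Theorems.GNineCriterion

end
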